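/-
Origin: expansion seat `planner-pub-hodgecm-prl1-g4-0`, handover #6 2026-08-18T07:55:25Z (`HOME/pub-hodgecm-prl1-g4/lean/Prl1g4/AdelicUnitaryRankOne.lean`, md5 2a6f0763, 228 lines);
landed by the gen-7 packager in gate run 26 as `HodgeCM/Automorphic/AdelicUnitaryRankOne.lean` (import ^import Prl1g4\.→import HodgeCM.Automorphic. ×1).
-/
/-
HodgeCM / automorphic layer — publication cell pub-hodgecm, EXPANSION PROVER a-1 (pub-hodgecm-prl1-g4, HANDOVER #6).
Imports my HANDOVER #5a `Prl1g4.AdelicUnitaryGroup` (↦ `HodgeCM.Automorphic.AdelicUnitaryGroup`) and the run-25 tree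
file `HodgeCM.PerL34.NormOneRelTorus` (pv11-g4).  Complete proofs, no new axioms, no hypotheses.
-/
import Summits.HodgeConjecture.HodgeCM.Automorphic.AdelicUnitaryGroup
import Summits.HodgeConjecture.HodgeCM.PerL34.NormOneRelTorus_2

/-!
# The rank-one case: `U(a)(𝔸_{L⁺}) = U(1)_{L/L⁺}(𝔸)` and the FIRST RUNG of the compactness criterion

For a hermitian LINE `(L, a x ȳ)`, `a ∈ L^×`, the adelic unitary group of HANDOVER #5a,
`adelicUnitaryGroup L !![a] ≤ GL₁(𝔸_L)`, is identified with pv11-g4's relative norm-one idele torus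
`NumberField.relNormOneIdeles L⁺ L = {y ∈ 𝔸_L^× : y ȳ = 1}` (`mem_relNormOneIdeles_iff_mul_conj`), its
rational points `adelicUnitaryRat` with `relNormOneRat = L¹`, and the compactness of
`U(a)(L⁺)\U(a)(𝔸_{L⁺})` — the `n = 1` case of the [PRINT] compactness criterion
`HodgeCM.PrintFact_unitaryCompact` of HANDOVER #5b (Margulis 1991, Ch. I Thm 3.2.1(b)) — becomes a
THEOREM: it is pv11-g4's KERNEL `compactSpace_relNormOneQuot` (Cassels' compactness of `C¹_L`,
pv10) transported along the identification.  This is a consistency check of #5a's modelling (same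
conjugation `c ⊗ id` as the torus lineage, rational points = principal ideles) and the first rung of
the PRINT family; it discharges nothing in PerL's regime (`n = 2, 3`).

* `HodgeCM.Adelic.scalarGL : Rˣ →* GL (Fin 1) R` and `GL (Fin 1) R →* Rˣ` (`det`) are inverse;
* `mem_adelicUnitaryGroup_fin_one_iff : g ∈ U(H)(𝔸) ↔ g₀₀ · (c ⊗ id) g₀₀ = 1` (`H₀₀ ≠ 0`);
* `torusToUnitary : relNormOneIdeles L⁺ L →* adelicUnitaryGroup L H`, continuous, surjective, carrying
  `relNormOneRat` into `adelicUnitaryRat`;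
* `compactSpace_adelicUnitaryQuot_fin_one : CompactSpace (U(H)(𝔸_{L⁺}) ⧸ U(H)(L⁺))` for every
  `H ∈ M₁(L)` with `H₀₀ ≠ 0` — KERNEL, no hypothesis.
-/

set_option autoImplicit false

noncomputable section

open NumberField IsDedekindDomain
open scoped Matrix

namespace HodgeCM.Adelic

open Literature.NumberTheory.Automorphic Literature.AlgebraicGeometry.ShimuraVarieties

/-! ## §1 `GL₁(R) = Rˣ` and `1 × 1` unitary relations -/

section FinOne

variable {R : Type*} [CommRing R]

/-- The `(0,0)` entry of a product of `1 × 1` matrices. -/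
theorem mul_apply_fin_one (A B : Matrix (Fin 1) (Fin 1) R) : (A * B) 0 0 = A 0 0 * B 0 0 := by
  simp [Matrix.mul_apply]

/-- A `1 × 1` matrix is the scalar matrix of its entry. -/
theorem eq_scalar_fin_one (A : Matrix (Fin 1) (Fin 1) R) : A = Matrix.scalar (Fin 1) (A 0 0) := by
  ext i j
  fin_cases i; fin_cases j
  simp [Matrix.scalar_apply]

/-- The `1 × 1` unitary relation `(σ g)ᵀ H g = H` is the scalar identity `σ(g₀₀) H₀₀ g₀₀ = H₀₀`. -/
theorem unitary_fin_one_iff (σ : R →+* R) (H g : Matrix (Fin 1) (Fin 1) R) :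
    (g.map σ)ᵀ * H * g = H ↔ σ (g 0 0) * H 0 0 * g 0 0 = H 0 0 := by
  constructor
  · intro h
    have h00 := congrFun (congrFun h 0) 0
    rwa [mul_apply_fin_one, mul_apply_fin_one, Matrix.transpose_apply, Matrix.map_apply] at h00
  · intro h
    ext i j
    fin_cases i; fin_cases j
    simpa [mul_apply_fin_one, Matrix.transpose_apply, Matrix.map_apply] using h

/-- When `H₀₀` is a unit, the `1 × 1` unitary relation is `g₀₀ · σ(g₀₀) = 1`. -/
theorem unitary_fin_one_iff_of_isUnit (σ : R →+* R) (H g : Matrix (Fin 1) (Fin 1) R)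
    (hH : IsUnit (H 0 0)) : (g.map σ)ᵀ * H * g = H ↔ g 0 0 * σ (g 0 0) = 1 := by
  rw [unitary_fin_one_iff, ← hH.mul_left_inj (b := g 0 0 * σ (g 0 0)) (c := 1), one_mul]
  constructor <;> intro h <;> linear_combination h

variable (R)

/-- `Rˣ → GL₁(R)`, `u ↦ (u)`. -/
def scalarGL : Rˣ →* GL (Fin 1) R := Units.map (Matrix.scalar (Fin 1) : R →+* _).toMonoidHom

/-- (Ported verbatim from the HodgeCMPerL package; no docstring in the source.) -/
@[simp] theorem val_scalarGL (u : Rˣ) :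
    ((scalarGL R u : GL (Fin 1) R) : Matrix (Fin 1) (Fin 1) R) = Matrix.scalar (Fin 1) (u : R) := rfl

/-- (Ported verbatim from the HodgeCMPerL package; no docstring in the source.) -/
theorem scalarGL_apply_zero (u : Rˣ) :
    ((scalarGL R u : GL (Fin 1) R) : Matrix (Fin 1) (Fin 1) R) 0 0 = u := by
  simp [Matrix.scalar_apply]

/-- `GL₁(R) → Rˣ` (the determinant) inverts `scalarGL`. -/
theorem scalarGL_det (g : GL (Fin 1) R) : scalarGL R (Matrix.GeneralLinearGroup.det g) = g := by
  ext i j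
  fin_cases i; fin_cases j
  simp [Matrix.scalar_apply, Matrix.GeneralLinearGroup.val_det_apply]

/-- (Ported verbatim from the HodgeCMPerL package; no docstring in the source.) -/
theorem det_scalarGL (u : Rˣ) : Matrix.GeneralLinearGroup.det (scalarGL R u) = u := by
  ext
  simp [Matrix.GeneralLinearGroup.val_det_apply]

/-- (Ported verbatim from the HodgeCMPerL package; no docstring in the source.) -/
theorem scalarGL_injective : Function.Injective (scalarGL R) :=
  Function.LeftInverse.injective (g := Matrix.GeneralLinearGroup.det) (det_scalarGL R)

/-- (Ported verbatim from the HodgeCMPerL package; no docstring in the source.) -/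
theorem continuous_scalarGL [TopologicalSpace R] [IsTopologicalRing R] : Continuous (scalarGL R) := by
  refine Continuous.units_map _ ?_
  change Continuous fun a : R => Matrix.scalar (Fin 1) a
  simp only [Matrix.scalar_apply]
  exact (continuous_pi fun _ => continuous_id).matrix_diagonal

end FinOne

/-! ## §2 `U(a)(𝔸_{L⁺}) = U(1)_{L/L⁺}(𝔸)` -/

section RankOne

variable (L : Type) [Field L] [NumberField L] [IsCMField L]

/-- Membership in the rank-one adelic unitary group: `g ∈ U(H)(𝔸_{L⁺}) ↔ g₀₀ · (c ⊗ id)(g₀₀) = 1`. -/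
theorem mem_adelicUnitaryGroup_fin_one_iff (H : Matrix (Fin 1) (Fin 1) L) (hH : H 0 0 ≠ 0)
    (g : GL (Fin 1) (AdeleRing (𝓞 L) L)) :
    g ∈ adelicUnitaryGroup L H ↔
      (g : Matrix (Fin 1) (Fin 1) (AdeleRing (𝓞 L) L)) 0 0 *
        adeleConj L ((g : Matrix (Fin 1) (Fin 1) (AdeleRing (𝓞 L) L)) 0 0) = 1 := by
  rw [mem_adelicUnitaryGroup_iff, unitary_fin_one_iff_of_isUnit]
  rw [Matrix.map_apply]
  exact (isUnit_iff_ne_zero.mpr hH).map _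

/-- Membership in the rational rank-one unitary group: `g ∈ U(H)(L⁺) ↔ g₀₀ · c(g₀₀) = 1`. -/
theorem mem_unitaryGroup_fin_one_iff (H : Matrix (Fin 1) (Fin 1) L) (hH : H 0 0 ≠ 0) (g : GL (Fin 1) L) :
    g ∈ unitaryGroup (conjRingHomK L) H ↔
      (g : Matrix (Fin 1) (Fin 1) L) 0 0 * conjRingHomK L ((g : Matrix (Fin 1) (Fin 1) L) 0 0) = 1 := by
  rw [mem_unitaryGroup_iff, unitary_fin_one_iff_of_isUnit _ _ _ (isUnit_iff_ne_zero.mpr hH)]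

/-- An idele of relative norm one, as an element of `U(H)(𝔸_{L⁺})` (`H ∈ M₁(L)`, `H₀₀ ≠ 0`). -/
theorem scalarGL_mem_adelicUnitaryGroup (H : Matrix (Fin 1) (Fin 1) L) (hH : H 0 0 ≠ 0)
    (y : ideleGroup L) (hy : y ∈ relNormOneIdeles (↥(maximalRealSubfield L)) L) :
    scalarGL (AdeleRing (𝓞 L) L) y ∈ adelicUnitaryGroup L H := by
  rw [mem_adelicUnitaryGroup_fin_one_iff L H hH, scalarGL_apply_zero, adeleConj_apply]
  have h := congrArg (fun u : ideleGroup L => (u : AdeleRing (𝓞 L) L))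
    ((mem_relNormOneIdeles_iff_mul_conj L y).mp hy)
  simpa using h

/-- **`U(1)_{L/L⁺}(𝔸) → U(H)(𝔸_{L⁺})`**, `y ↦ (y)`, for a hermitian line `H = (a)`, `a ≠ 0`. -/
def torusToUnitary (H : Matrix (Fin 1) (Fin 1) L) (hH : H 0 0 ≠ 0) :
    relNormOneIdeles (↥(maximalRealSubfield L)) L →* adelicUnitaryGroup L H where
  toFun y := ⟨scalarGL (AdeleRing (𝓞 L) L) (y : ideleGroup L),
    scalarGL_mem_adelicUnitaryGroup L H hH y y.2⟩
  map_one' := Subtype.ext (map_one _)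
  map_mul' _ _ := Subtype.ext (map_mul _ _ _)

/-- (Ported verbatim from the HodgeCMPerL package; no docstring in the source.) -/
@[simp] theorem coe_torusToUnitary (H : Matrix (Fin 1) (Fin 1) L) (hH : H 0 0 ≠ 0)
    (y : relNormOneIdeles (↥(maximalRealSubfield L)) L) :
    ((torusToUnitary L H hH y : adelicUnitaryGroup L H) : GL (Fin 1) (AdeleRing (𝓞 L) L)) =
      scalarGL (AdeleRing (𝓞 L) L) (y : ideleGroup L) := rfl

/-- (Ported verbatim from the HodgeCMPerL package; no docstring in the source.) -/
theorem continuous_torusToUnitary (H : Matrix (Fin 1) (Fin 1) L) (hH : H 0 0 ≠ 0) :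
    Continuous (torusToUnitary L H hH) :=
  Continuous.subtype_mk ((continuous_scalarGL _).comp continuous_subtype_val) _

/-- (Ported verbatim from the HodgeCMPerL package; no docstring in the source.) -/
theorem torusToUnitary_injective (H : Matrix (Fin 1) (Fin 1) L) (hH : H 0 0 ≠ 0) :
    Function.Injective (torusToUnitary L H hH) := by
  intro a b h
  have h' := congrArg (fun γ : adelicUnitaryGroup L H => (γ : GL (Fin 1) (AdeleRing (𝓞 L) L))) h
  exact Subtype.ext (scalarGL_injective _ (by simpa using h'))

/-- **`U(1)_{L/L⁺}(𝔸) → U(H)(𝔸_{L⁺})` is onto**: every `g ∈ U(H)(𝔸)` is `(y)` with `y = det g = g₀₀` of norm one. -/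
theorem torusToUnitary_surjective (H : Matrix (Fin 1) (Fin 1) L) (hH : H 0 0 ≠ 0) :
    Function.Surjective (torusToUnitary L H hH) := by
  rintro ⟨g, hg⟩
  have hg' := (mem_adelicUnitaryGroup_fin_one_iff L H hH g).mp hg
  refine ⟨⟨Matrix.GeneralLinearGroup.det g, ?_⟩, ?_⟩
  · rw [mem_relNormOneIdeles_iff_mul_conj]
    ext
    rw [Units.val_mul, AdeleRing.coe_smul_units, ← adeleConj_apply, Matrix.GeneralLinearGroup.val_det_apply,
      Matrix.det_fin_one, Units.val_one]
    exact hg'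
  · exact Subtype.ext (scalarGL_det _ g)

/-- A principal norm-one idele `(ℓ)_𝔸` goes to a RATIONAL point: `(ℓ) ∈ U(H)(L⁺)`. -/
theorem torusToUnitary_mem_rat (H : Matrix (Fin 1) (Fin 1) L) (hH : H 0 0 ≠ 0)
    (y : relNormOneIdeles (↥(maximalRealSubfield L)) L) (hy : y ∈ relNormOneRat (↥(maximalRealSubfield L)) L) :
    torusToUnitary L H hH y ∈ adelicUnitaryRat L H := by
  rw [mem_adelicUnitaryRat_iff]
  obtain ⟨ℓ, hℓ⟩ := (mem_relNormOneRat_iff _ L y).mp hy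
  -- `ℓ c(ℓ) = 1` in `L`, by injectivity of `L → 𝔸_L`
  have h1 : (y : ideleGroup L) * IsCMField.complexConj L • (y : ideleGroup L) = 1 :=
    (mem_relNormOneIdeles_iff_mul_conj L (y : ideleGroup L)).mp y.2
  have h2 : algebraMap L (AdeleRing (𝓞 L) L) ((ℓ : L) * conjRingHomK L ℓ) = algebraMap L _ 1 := by
    have h := congrArg (fun u : ideleGroup L => (u : AdeleRing (𝓞 L) L)) h1
    simp only [Units.val_mul, AdeleRing.coe_smul_units, Units.val_one] at h
    rw [← hℓ, Units.coe_map, MonoidHom.coe_coe, ← adeleConj_apply, adeleConj_algebraMap, ← map_mul] at h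
    rw [h, map_one]
  have h3 : (ℓ : L) * conjRingHomK L ℓ = 1 := (algebraMap L (AdeleRing (𝓞 L) L)).injective h2
  refine ⟨scalarGL L ℓ, ?_, ?_⟩
  · rw [mem_unitaryGroup_fin_one_iff L H hH, scalarGL_apply_zero]
    exact h3
  · ext i j
    fin_cases i; fin_cases j
    simp [Matrix.scalar_apply, ← hℓ]

/-- **FIRST RUNG of the compactness criterion, KERNEL**: for a hermitian line `H = (a) ∈ M₁(L)`, `a ≠ 0`,
the adelic quotient `U(H)(L⁺)\U(H)(𝔸_{L⁺})` is compact — pv11-g4's `compactSpace_relNormOneQuot`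
(`[U(1)_{L/L⁺}] = L¹\U(1)(𝔸)` compact, from Cassels' compactness of `C¹_L`, pv10) pushed forward along the
continuous surjection `torusToUnitary`.  This is `HodgeCM.AdelicQuotientCompact L H` of HANDOVER #5b
(by `Iff.rfl`), i.e. the `n = 1` instance of `HodgeCM.PrintFact_unitaryCompact`, now hypothesis-free. -/
theorem compactSpace_adelicUnitaryQuot_fin_one (H : Matrix (Fin 1) (Fin 1) L) (hH : H 0 0 ≠ 0) :
    CompactSpace (adelicUnitaryGroup L H ⧸ adelicUnitaryRat L H) := by
  let K : Type := ↥(maximalRealSubfield L)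
  let φ := torusToUnitary L H hH
  let ψ : relNormOneIdeles K L ⧸ relNormOneRat K L → adelicUnitaryGroup L H ⧸ adelicUnitaryRat L H :=
    Quotient.lift (s := QuotientGroup.leftRel (relNormOneRat K L))
      (fun y => (QuotientGroup.mk (φ y) : adelicUnitaryGroup L H ⧸ adelicUnitaryRat L H))
      (fun a b hab => by
        apply QuotientGroup.eq.mpr
        rw [← map_inv, ← map_mul]
        exact torusToUnitary_mem_rat L H hH _ (QuotientGroup.leftRel_apply.mp hab))
  have hψc : Continuous ψ :=
    Continuous.quotient_lift (QuotientGroup.continuous_mk.comp (continuous_torusToUnitary L H hH)) _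
  have hψs : Function.Surjective ψ := by
    intro x
    induction x using QuotientGroup.induction_on with
    | H γ =>
      obtain ⟨y, hy⟩ := torusToUnitary_surjective L H hH γ
      exact ⟨QuotientGroup.mk y, by simp [ψ, φ, hy]⟩
  exact ⟨by rw [← hψs.range_eq]; exact isCompact_range hψc⟩

end RankOne

end HodgeCM.Adelic

end
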